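import Summits.Schanuel.Schanuel.Theorems.RootDecomp1BChannelCountSplit
import Summits.Schanuel.Schanuel.Theorems.RootDecomp1BDefectFloor

/-!
# RootDecomp1BChannelCount — part 3/4 (Core): sandwiches, the deciding theorems with seven binders, WEAKER(evidence) and exactness

W0 ⟸ SD0 ⟸ SRL ∧ T0 ∧ W0 (`wildSharpDefectZeroStep_of_sharpDefectZero`, `sharpDefectZeroStep_of_pieces9`), T0 ⟸ SD0 ∧ TS1; `closes11` / `closes11T`
CALL the live deciding theorem `Summit.Schanuel.Schanuel.Theses.RootDecomp1B.closes` (rev 30, nine binders) with W0 resp. {T0, W0} replaced; every new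
piece follows from X = `KleinPolarSchanuel` and from S; `kleinPolarSchanuel_iff_pieces11{,T,_split}`, `schanuel_iff_binders11` (exactness).  Included here
for the first time in the tree (never landed in rounds ≤ 10): the X ⟹ piece chain of lens 4's node (`kleinPolarSchanuel_of_schanuel`,
`localSurplusBudget_of_kleinPolarSchanuel`, `freeSideCoupling_…`, `tightBudgetCoupling_…`, `sharpRelativeLindemann_…`, `tameDefectZeroStep_…`,
`tameSurplusOneStep_…`, `noWildAbsorbingSlack_…`, via the retired gen-1 piece `SideSurplusBudget`) and the EQUIV-layer facts `assembly_holds`,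
`conjStableReduction_of_schanuel`, `polarOfConjStable_of_schanuel` — all stated over the LIVE route declarations.  § Gen 11 of lens 4's ChannelCount.lean
(705da1e0…); `--supports stmt-Schanuel-32408`.  Sorry-free; standard axioms; nothing here proves Schanuel; rung 0.
-/

open Complex IntermediateField
open Literature.NumberTheory.Transcendental (trdeg_adjoin_le_of_le isAlgebraic_adjoin_over_algebraAdjoin nesterenko algebraicIndependent_exp_holds transcendental_pi_holds)

namespace Summit.Schanuel.Schanuel.Theorems.RootDecomp1BChannelCount

set_option linter.dupNamespace false

open Summit.Schanuel.Schanuel.Theses.RootDecomp1B (Assembly ConjStableReduction FreeSideCoupling KleinPolarSchanuel LocalSurplusBudget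
  NoWildAbsorbingSlackFirstFailure PolarOfConjStable SharpRelativeLindemann TameDefectZeroStep TameSurplusOneStep TightBudgetCoupling
  WildSharpDefectZeroStep closes)
open Summit.Schanuel.Schanuel.Theorems.RootDecomp1BFedFlagCore (polarDeg polarDeg_init_le polarDeg_lt_aleph0 two_mul_le_polarDeg_init)
open Summit.Schanuel.Schanuel.Theorems.RootDecomp1BTameFlagCore (TameKleinPolar isTame_or_isWild tameKleinPolar_of_flag_steps
  tameSurplusOneStep_of_tameKleinPolar)
open Summit.Schanuel.Schanuel.Theorems.RootDecomp1BDefectFloorCore (tameSharpStep_of_floor tameSurplusOneStep_of_tameDefectZero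
  wildSharpDefectZeroStep_iff_init wildSharpInit_of_floor)
open Summit.Schanuel.Schanuel.Theorems.RootDecomp1BDefectFloorCells (linearIndependent_polar polar_trdeg_add_rank_le_sides)
open Summit.Schanuel.Schanuel.Theorems.RootDecomp1BDefectFloor (kleinPolarSchanuel_of_pieces9)

section

variable {m : ℕ}

/-- (gen-≤10 declaration of the node, never landed before; included by dependency closure) aside · SSB · the GLOBAL budget of v3 — NOT a piece (v3.1): COSTUME by the critic's cosine-padding
collapse (VERDICT 2026-08-30T03:34:58Z): for ℚ-free real r let c_T ⊆ {cos r_j} extend r to a ℚ-basis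
(r, c_T) of span_ℚ(r, cos r); then ℚ(r, c_T, e^r) ⊆ ℚ(r, i r, e^r, e^{i r}) gives a″ ≤ t + ℓ and
e^{i r_j} = cos r_j + i sin r_j algebraic over ℚ(r, c_T) gives b″ ≤ ρ″ + ℓ, so SSB at (r, c_T) yields
t ≥ 2m: SSB ⟹ KleinPolarSchanuel, whence SSB ⟺ X (with `sideSurplusBudget_of_kleinPolarSchanuel`);
KERNEL: `CriticL4g3.sideSurplusBudget_iff_kleinPolarSchanuel` (Appendix C, the critic's certificate copied with credit).
Kept as a definition because the kernel arrows SSB ⟹ LSB, SSB ⟹ RealSchanuel ∧ UnitarySchanuel and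
X ⟹ SSB are used in the bookkeeping, and because «Schanuel ⟺ the global budget inequality» (modulo the
two provable supports) is a by-product reformulation worth recording. -/
def SideSurplusBudget : Prop :=
  ∀ (m : ℕ) (r : Fin m → ℝ), LinearIndependent ℚ r →
    ((m + m : ℕ) : Cardinal) +
        Algebra.trdeg ℚ ↥(IntermediateField.adjoin ℚ (Set.range (fun j => ((r j : ℝ) : ℂ)))) ≤
      Algebra.trdeg ℚ ↥(IntermediateField.adjoin ℚ
          (Set.range (fun j => ((r j : ℝ) : ℂ)) ∪ Set.range (Complex.exp ∘ fun j => ((r j : ℝ) : ℂ)))) +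
        Algebra.trdeg ℚ ↥(IntermediateField.adjoin ℚ
          (Set.range (fun j => ((r j : ℝ) : ℂ) * Complex.I) ∪
            Set.range (Complex.exp ∘ fun j => ((r j : ℝ) : ℂ) * Complex.I)))

/-- (gen-≤10 declaration of the node, never landed before; included by dependency closure) The EQUIV layer, nontrivial direction (verbatim gen 0). -/
theorem assembly_holds : Assembly := by
  intro hConj hPolar hX
  show ∀ (n : ℕ) (z : Fin n → ℂ), LinearIndependent ℚ z →
    (n : Cardinal) ≤ Algebra.trdeg ℚ
      ↥(IntermediateField.adjoin ℚ (Set.range z ∪ Set.range (Complex.exp ∘ z)))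
  intro n z hz
  by_contra hlt
  rw [not_le] at hlt
  obtain ⟨d, w, hw, hwconj, hwlt⟩ := hConj n z hz hlt
  obtain ⟨m, r, hr, hfail⟩ := hPolar d w hw hwconj hwlt
  exact absurd (hX m r hr) (not_le.mpr hfail)

/-- (gen-≤10 declaration of the node, never landed before; included by dependency closure) -/
theorem conjStableReduction_of_schanuel (hS : _root_.Schanuel) : ConjStableReduction :=
  fun n z hz hlt => absurd (hS n z hz) (not_le.mpr hlt)

/-- (gen-≤10 declaration of the node, never landed before; included by dependency closure) -/
theorem polarOfConjStable_of_schanuel (hS : _root_.Schanuel) : PolarOfConjStable :=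
  fun d w hw _ hlt => absurd (hS d w hw) (not_le.mpr hlt)

/-- (gen-≤10 declaration of the node, never landed before; included by dependency closure) -/
theorem kleinPolarSchanuel_of_schanuel (hS : _root_.Schanuel) : KleinPolarSchanuel :=
  fun m _ hr => hS (m + m) _ (linearIndependent_polar hr)

/-- (gen-≤10 declaration of the node, never landed before; included by dependency closure) X ⟹ SSB: Schanuel's inequality for the polar tuple plus the entanglement inequality (E). -/
theorem sideSurplusBudget_of_kleinPolarSchanuel (hX : KleinPolarSchanuel) : SideSurplusBudget :=
  fun m r hr => (add_le_add (hX m r hr) le_rfl).trans (polar_trdeg_add_rank_le_sides r)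

/-- (gen-≤10 declaration of the node, never landed before; included by dependency closure) SSB ⟹ LSB (drop the induction hypothesis). -/
theorem localSurplusBudget_of_sideSurplusBudget (h : SideSurplusBudget) : LocalSurplusBudget :=
  fun m r hr _ => h m r hr

/-- (gen-≤10 declaration of the node, never landed before; included by dependency closure) X ⟹ LSB. -/
theorem localSurplusBudget_of_kleinPolarSchanuel (hX : KleinPolarSchanuel) : LocalSurplusBudget :=
  localSurplusBudget_of_sideSurplusBudget (sideSurplusBudget_of_kleinPolarSchanuel hX)

/-- (gen-≤10 declaration of the node, never landed before; included by dependency closure) The new pieces also follow from the TARGET X alone (they sit beneath the EQUIV layer). -/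
theorem freeSideCoupling_of_kleinPolarSchanuel (hX : KleinPolarSchanuel) : FreeSideCoupling :=
  fun m r hr _ _ _ _ => hX m r hr

/-- (gen-≤10 declaration of the node, never landed before; included by dependency closure) The new pieces also follow from the TARGET X alone (they sit beneath the EQUIV layer). -/
theorem tightBudgetCoupling_of_kleinPolarSchanuel (hX : KleinPolarSchanuel) : TightBudgetCoupling :=
  fun m r hr _ _ _ _ _ _ => hX m r hr

/-- (gen-≤10 declaration of the node, never landed before; included by dependency closure) -/
theorem tameKleinPolar_of_kleinPolarSchanuel (hX : KleinPolarSchanuel) : TameKleinPolar :=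
  fun m r hr _ _ => hX m r hr

/-- (gen-≤10 declaration of the node, never landed before; included by dependency closure) -/
theorem tameSurplusOneStep_of_kleinPolarSchanuel (hX : KleinPolarSchanuel) : TameSurplusOneStep :=
  tameSurplusOneStep_of_tameKleinPolar (tameKleinPolar_of_kleinPolarSchanuel hX)

/-- (gen-≤10 declaration of the node, never landed before; included by dependency closure) -/
theorem noWildAbsorbingSlack_of_kleinPolarSchanuel (hX : KleinPolarSchanuel) : NoWildAbsorbingSlackFirstFailure :=
  fun m r hr _ _ _ _ _ _ _ _ => hX m r hr

/-- (gen-≤10 declaration of the node, never landed before; included by dependency closure) -/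
theorem sharpRelativeLindemann_of_kleinPolarSchanuel (hX : KleinPolarSchanuel) : SharpRelativeLindemann := by
  intro m r hr _ _
  have hle : ((m + m + 1 : ℕ) : Cardinal) ≤ ((m + 1 + (m + 1) : ℕ) : Cardinal) := by
    exact_mod_cast (by omega : m + m + 1 ≤ m + 1 + (m + 1))
  exact hle.trans (hX (m + 1) r hr)

/-- (gen-≤10 declaration of the node, never landed before; included by dependency closure) -/
theorem tameDefectZeroStep_of_kleinPolarSchanuel (hX : KleinPolarSchanuel) : TameDefectZeroStep :=
  fun m r hr _ _ _ => hX (m + 1) r hr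

/-- W0 ⟸ SD0 (through the coordinate form of W0: the wildness hypothesis is simply not used). -/
theorem wildSharpDefectZeroStep_of_sharpDefectZero (h : SharpDefectZeroStep) : WildSharpDefectZeroStep :=
  wildSharpDefectZeroStep_iff_init.mpr fun m r hr hIH _ hle hfl => h m r hr hIH hle hfl

/-- SD0 ⟸ SRL ∧ T0 ∧ W0: a sharp tuple is tame — then the tame flag (TSH ⟸ SRL ⊕ T0, TS1 ⟸ T0) — or wild — then
`wildSharpInit_of_floor`. -/
theorem sharpDefectZeroStep_of_pieces9 (hF : SharpRelativeLindemann) (hT : TameDefectZeroStep)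
    (hW : WildSharpDefectZeroStep) : SharpDefectZeroStep := by
  intro m r hr hIH hle _
  rcases isTame_or_isWild r with ht | hw
  · exact tameKleinPolar_of_flag_steps (tameSharpStep_of_floor hF hT) (tameSurplusOneStep_of_tameDefectZero hT)
      (m + 1) r hr hIH ht
  · exact wildSharpInit_of_floor hF hW m r hr hIH hw hle

/-- T0 ⟸ SD0 ∧ TS1 by the flag trichotomy `t(r') = 2m` (SD0) | `t(r') = 2m + 1` (TS1) | `t(r') ≥ 2m + 2` (monotonicity). -/
theorem tameDefectZeroStep_of_sharpDefectZero_tameSurplusOne (h0 : SharpDefectZeroStep) (h1 : TameSurplusOneStep) :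
    TameDefectZeroStep := by
  intro m r hr hIH ht hfl
  have hlow := two_mul_le_polarDeg_init hr hIH
  have hmono := polarDeg_init_le r
  obtain ⟨n', hn'⟩ := Cardinal.lt_aleph0.mp (polarDeg_lt_aleph0 (Fin.init r))
  rw [hn'] at hlow hmono
  have hlow' : m + m ≤ n' := by exact_mod_cast hlow
  rcases Nat.lt_or_ge n' (m + m + 1) with hlt | hge
  · have h4 : polarDeg (Fin.init r) ≤ ((m + m : ℕ) : Cardinal) := by
      rw [hn']
      exact_mod_cast (by omega : n' ≤ m + m)
    exact h0 m r hr hIH h4 hfl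
  · rcases Nat.lt_or_ge n' (m + m + 2) with hlt2 | hge2
    · have h4 : polarDeg (Fin.init r) = ((m + m + 1 : ℕ) : Cardinal) := by
        rw [hn']
        exact_mod_cast (by omega : n' = m + m + 1)
      exact h1 m r hr hIH ht h4
    · calc ((m + 1 + (m + 1) : ℕ) : Cardinal) ≤ (n' : Cardinal) := by exact_mod_cast (by omega : m + 1 + (m + 1) ≤ n')
        _ ≤ polarDeg r := hmono

/-- {SRL, T0, SD0} ⟺ {SRL, T0, W0}. -/
theorem pieces11_iff_pieces9 :
    (SharpRelativeLindemann ∧ TameDefectZeroStep ∧ SharpDefectZeroStep) ↔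
      (SharpRelativeLindemann ∧ TameDefectZeroStep ∧ WildSharpDefectZeroStep) :=
  ⟨fun h => ⟨h.1, h.2.1, wildSharpDefectZeroStep_of_sharpDefectZero h.2.2⟩,
    fun h => ⟨h.1, h.2.1, sharpDefectZeroStep_of_pieces9 h.1 h.2.1 h.2.2⟩⟩

/-- {SRL, SD0, TS1} ⟺ {SRL, T0, W0} (the tidy variant: T0 traded for its surplus-one half TS1). -/
theorem pieces11T_iff_pieces9 :
    (SharpRelativeLindemann ∧ SharpDefectZeroStep ∧ TameSurplusOneStep) ↔
      (SharpRelativeLindemann ∧ TameDefectZeroStep ∧ WildSharpDefectZeroStep) :=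
  ⟨fun h => ⟨h.1, tameDefectZeroStep_of_sharpDefectZero_tameSurplusOne h.2.1 h.2.2,
      wildSharpDefectZeroStep_of_sharpDefectZero h.2.1⟩,
    fun h => ⟨h.1, sharpDefectZeroStep_of_pieces9 h.1 h.2.1 h.2.2, tameSurplusOneStep_of_tameDefectZero h.2.1⟩⟩

/-- PATH F″: `closes` with W0 replaced by SD0. -/
theorem closes11 (hConj : ConjStableReduction) (hPolar : PolarOfConjStable) (hLSB : LocalSurplusBudget)
    (hFree : FreeSideCoupling) (hTight : TightBudgetCoupling) (hSRL : SharpRelativeLindemann)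
    (hT0 : TameDefectZeroStep) (hSD0 : SharpDefectZeroStep) (hWAS : NoWildAbsorbingSlackFirstFailure) :
    _root_.Schanuel :=
  closes hConj hPolar hLSB hFree hTight hSRL hT0 (wildSharpDefectZeroStep_of_sharpDefectZero hSD0) hWAS

/-- PATH F: `closes` with {T0, W0} replaced by {SD0, TS1}. -/
theorem closes11T (hConj : ConjStableReduction) (hPolar : PolarOfConjStable) (hLSB : LocalSurplusBudget)
    (hFree : FreeSideCoupling) (hTight : TightBudgetCoupling) (hSRL : SharpRelativeLindemann)
    (hSD0 : SharpDefectZeroStep) (hTS1 : TameSurplusOneStep) (hWAS : NoWildAbsorbingSlackFirstFailure) :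
    _root_.Schanuel :=
  closes hConj hPolar hLSB hFree hTight hSRL (tameDefectZeroStep_of_sharpDefectZero_tameSurplusOne hSD0 hTS1)
    (wildSharpDefectZeroStep_of_sharpDefectZero hSD0) hWAS

/-- PATH F″ with the split consumed: TC and JI in place of SD0 (eight hypotheses — for the record only; the route keeps
SD0 as the binder and TC, JI as its split children). -/
theorem closes11_split (hConj : ConjStableReduction) (hPolar : PolarOfConjStable) (hLSB : LocalSurplusBudget)
    (hFree : FreeSideCoupling) (hTight : TightBudgetCoupling) (hSRL : SharpRelativeLindemann)
    (hT0 : TameDefectZeroStep) (hTC : SharpSecondChannel) (hJI : TwoChannelDefectZeroStep)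
    (hWAS : NoWildAbsorbingSlackFirstFailure) : _root_.Schanuel :=
  closes11 hConj hPolar hLSB hFree hTight hSRL hT0 (sharpDefectZeroGlue11_holds hTC hJI) hWAS

/-- WEAKER(evidence): X ⟹ SD0. -/
theorem sharpDefectZeroStep_of_kleinPolarSchanuel (hX : KleinPolarSchanuel) : SharpDefectZeroStep :=
  fun m r hr _ _ _ => hX (m + 1) r hr

/-- WEAKER(evidence): X ⟹ TC. -/
theorem sharpSecondChannel_of_kleinPolarSchanuel (hX : KleinPolarSchanuel) : SharpSecondChannel :=
  (sharpDefectZeroStep_iff_channels.mp (sharpDefectZeroStep_of_kleinPolarSchanuel hX)).1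

/-- WEAKER(evidence): X ⟹ JI. -/
theorem twoChannelDefectZeroStep_of_kleinPolarSchanuel (hX : KleinPolarSchanuel) : TwoChannelDefectZeroStep :=
  (sharpDefectZeroStep_iff_channels.mp (sharpDefectZeroStep_of_kleinPolarSchanuel hX)).2

/-- WEAKER(evidence): S ⟹ SD0. -/
theorem sharpDefectZeroStep_of_schanuel (hS : _root_.Schanuel) : SharpDefectZeroStep :=
  sharpDefectZeroStep_of_kleinPolarSchanuel (kleinPolarSchanuel_of_schanuel hS)

/-- WEAKER(evidence): S ⟹ TC. -/
theorem sharpSecondChannel_of_schanuel (hS : _root_.Schanuel) : SharpSecondChannel :=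
  sharpSecondChannel_of_kleinPolarSchanuel (kleinPolarSchanuel_of_schanuel hS)

/-- WEAKER(evidence): S ⟹ JI. -/
theorem twoChannelDefectZeroStep_of_schanuel (hS : _root_.Schanuel) : TwoChannelDefectZeroStep :=
  twoChannelDefectZeroStep_of_kleinPolarSchanuel (kleinPolarSchanuel_of_schanuel hS)

/-- EXACTNESS of PATH F″: X ⟺ the seven binders of `closes11` beneath the EQUIV layer. -/
theorem kleinPolarSchanuel_iff_pieces11 :
    KleinPolarSchanuel ↔ (LocalSurplusBudget ∧ FreeSideCoupling ∧ TightBudgetCoupling ∧ SharpRelativeLindemann ∧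
      TameDefectZeroStep ∧ SharpDefectZeroStep ∧ NoWildAbsorbingSlackFirstFailure) :=
  ⟨fun hX => ⟨localSurplusBudget_of_kleinPolarSchanuel hX, freeSideCoupling_of_kleinPolarSchanuel hX,
      tightBudgetCoupling_of_kleinPolarSchanuel hX, sharpRelativeLindemann_of_kleinPolarSchanuel hX,
      tameDefectZeroStep_of_kleinPolarSchanuel hX, sharpDefectZeroStep_of_kleinPolarSchanuel hX,
      noWildAbsorbingSlack_of_kleinPolarSchanuel hX⟩,
    fun h => kleinPolarSchanuel_of_pieces9 h.1 h.2.1 h.2.2.1 h.2.2.2.1 h.2.2.2.2.1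
      (wildSharpDefectZeroStep_of_sharpDefectZero h.2.2.2.2.2.1) h.2.2.2.2.2.2⟩

/-- EXACTNESS of PATH F: X ⟺ the seven binders of `closes11T`. -/
theorem kleinPolarSchanuel_iff_pieces11T :
    KleinPolarSchanuel ↔ (LocalSurplusBudget ∧ FreeSideCoupling ∧ TightBudgetCoupling ∧ SharpRelativeLindemann ∧
      SharpDefectZeroStep ∧ TameSurplusOneStep ∧ NoWildAbsorbingSlackFirstFailure) :=
  ⟨fun hX => ⟨localSurplusBudget_of_kleinPolarSchanuel hX, freeSideCoupling_of_kleinPolarSchanuel hX,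
      tightBudgetCoupling_of_kleinPolarSchanuel hX, sharpRelativeLindemann_of_kleinPolarSchanuel hX,
      sharpDefectZeroStep_of_kleinPolarSchanuel hX, tameSurplusOneStep_of_kleinPolarSchanuel hX,
      noWildAbsorbingSlack_of_kleinPolarSchanuel hX⟩,
    fun h => kleinPolarSchanuel_of_pieces9 h.1 h.2.1 h.2.2.1 h.2.2.2.1
      (tameDefectZeroStep_of_sharpDefectZero_tameSurplusOne h.2.2.2.2.1 h.2.2.2.2.2.1)
      (wildSharpDefectZeroStep_of_sharpDefectZero h.2.2.2.2.1) h.2.2.2.2.2.2⟩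

/-- … and with the split: X ⟺ {LSB, Free, Tight, SRL, T0, TC, JI, WAS}. -/
theorem kleinPolarSchanuel_iff_pieces11_split :
    KleinPolarSchanuel ↔ (LocalSurplusBudget ∧ FreeSideCoupling ∧ TightBudgetCoupling ∧ SharpRelativeLindemann ∧
      TameDefectZeroStep ∧ SharpSecondChannel ∧ TwoChannelDefectZeroStep ∧ NoWildAbsorbingSlackFirstFailure) := by
  rw [kleinPolarSchanuel_iff_pieces11, sharpDefectZeroStep_iff_channels]
  tauto

/-- S ⟺ Conj ∧ Polar ∧ the seven binders of `closes11` (the EQUIV layer is a theorem pair: `assembly_holds`,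
`conjStableReduction_of_schanuel`, `polarOfConjStable_of_schanuel`). -/
theorem schanuel_iff_binders11 :
    _root_.Schanuel ↔ (ConjStableReduction ∧ PolarOfConjStable ∧ LocalSurplusBudget ∧ FreeSideCoupling ∧
      TightBudgetCoupling ∧ SharpRelativeLindemann ∧ TameDefectZeroStep ∧ SharpDefectZeroStep ∧
      NoWildAbsorbingSlackFirstFailure) := by
  constructor
  · intro hS
    exact ⟨conjStableReduction_of_schanuel hS, polarOfConjStable_of_schanuel hS,
      kleinPolarSchanuel_iff_pieces11.mp (kleinPolarSchanuel_of_schanuel hS)⟩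
  · rintro ⟨hC, hP, h⟩
    exact assembly_holds hC hP (kleinPolarSchanuel_iff_pieces11.mpr h)

end

end Summit.Schanuel.Schanuel.Theorems.RootDecomp1BChannelCount
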